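import Summits.Ventures.GridStability.Lyapunov.WSCC9LossySplitLinesDualData
import Summits.Ventures.GridStability.Bench.WSCC9LossySplitLinesRoa
import Summits.Ventures.GridStability.Lyapunov.WSCC9LossySlabDual
import HarnessLib

/-!
# «SPLITU-CEILING» — the slab/Popov certificate class on the UNORDERED-LINES split presentation of the
# lossy 9-bus is EMPTY from `2·arctan(71/1000)` on (file 2 of 2: the dual witness over `ℝ` and the theorem)

**OBSTRUCTION row beside «SPLITU-8°» (#122-cand).**  For the unordered-lines split Lur'e object of the
post-fault WSCC 3-machine classical model WITH transfer conductances, `S = WSCC9.splitLurieLinesSystem`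
(MODEL M′ = `WSCC9.postB_SPdamp.toModel`: post-fault-B Kron reduction, h12 couplings, non-uniform damping
`D_i/M_i = 1/10, 1/5, 3/10`; Pai's split presentation (3.43) with one sine and one cosine channel per
ordered pair, `Models/WSCC9SplitLurieLines.lean`), and the window `γ₀ = 2·arctan(71/1000)` (≈ 8.122°):

* `D : SlabDualWitness WSCC9.splitLurieLinesSystem a0 b0` — lit-6's dual witness (Literature
  `LuriePostnikovSlabDualWitness.lean`: `Z ⪰ 0`, (D1) `W + Wᵀ ⪰ 0` EXACTLY (rational `B`), (D2), (D3),
  (D4)), every field from the kernel decisions of file 1 by cast identities;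
* `no_splitSlabCertificate_at` — **no** `Λ : SlabCertificate WSCC9.splitLurieLinesSystem` satisfies the sector
  hypothesis `hsec` of lit-6's ROA theorem (`well_subset_regionOfAttraction`, the hypothesis #122's
  `WSCC9LossySplitLines.hsec` discharges at `2·arctan(7/100)`) for the window `γ₀`;
* `no_splitSlabCertificate` / `splitSlabClass_empty` / `no_splitSlabCertificate_perChannel` — nor for any
  window (function) `≥ γ₀` (on the twelve channels `p ≠ q`);
* `splitClassCeiling_bracket` — the class is NON-EMPTY at #122's `2·arctan(7/100)` (≈ 8.008°, `cert` with
  its `hsec`, by name) and EMPTY from `2·arctan(71/1000)` (≈ 8.122°): the split class optimum lies in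
  `(8.008°, 8.122°]`;
* `presentationLever` — ONE kernel object for the lever sentence: at the window `2·arctan(7/100)` the
  directed-polar class of record on `M′ = WSCC9.lurieSystem` is EMPTY (★ #74 `WSCC9LossySlabDual`) while the
  unordered-lines split class on the same machine model is NON-EMPTY (#122);
* `γ_lt_γ₀`, `γ₀_le` — the bracket's windows in closed form.

THREE COLUMNS.  CERTIFIED: «no certificate of the typed split class (`SlabCertificate WSCC9.splitLurieLinesSystem` + `hsec`)
certifies a slab half-width `≥ 2·arctan(71/1000)` (≈ 8.122°); with #122 the class optimum is in
`(2·arctan(7/100), 2·arctan(71/1000)]` = (8.008°, 8.122°]; the presentation lever (directed-polar → unordered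
split) is worth MORE THAN `2·arctan(7/100) − 2·arctan(33/500)` ≈ 0.46° of window against the class of record
(«#74′»: polar EMPTY from 7.552°) and AT MOST `2·arctan(71/1000) − 2·arctan(13/200)` ≈ 0.68° (★ #35 NON-EMPTY
at 7.438°)».  VALIDATED (floats, lit-6 kit j288785): dual margin `μ*` / primal margin `ν*` change sign together
between `u = 7/100` (`-2.3e-07` / `5.0e-04`) and `71/1000` (`5.0e-07` / `-9.3e-04`).
MODELLED: as #122 (object identity = `WSCC9LossySplitLines.A_eq/C_eq/B_eq`, by name).  The sentence is
about the CERTIFICATE CLASS, not about the region of attraction of `M′` or of any grid.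
[cite: BoydVandenberghe2004, §5.9.4 (5.97)–(5.98), Example 5.14; Pai1981, §3.6.3 (3.43)–(3.45), §4.6 p. 117]
-/

noncomputable section

open Real Matrix
open Literature.Computation.Certificates
open Literature.MathematicalPhysics.PowerSystems
open Literature.MathematicalPhysics.PowerSystems.LyapunovFunctionFamily
open Summit.Ventures.GridStability.Models
open Summit.Ventures.GridStability.Lyapunov.WSCC9LossySplitSlab (e1 eκ e2 AQ CQ)
open Summit.Ventures.GridStability.Lyapunov.WSCC9LossySplitLines (BLQ A_eq C_eq B_eq)

namespace Summit.Ventures.GridStability.Lyapunov.WSCC9LossySplitLinesDual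

/-! ### Cast plumbing (the parent files' copies are private) -/

/-- `(M + N) ↦ ℝ` (cast plumbing). -/ private theorem map_add' {m n : Type*} (M N : Matrix m n ℚ) :
    (M + N).map (Rat.cast : ℚ → ℝ) = M.map (Rat.cast : ℚ → ℝ) + N.map (Rat.cast : ℚ → ℝ) := by
  ext i k; simp
/-- `(M − N) ↦ ℝ` (cast plumbing). -/ private theorem map_sub' {m n : Type*} (M N : Matrix m n ℚ) :
    (M - N).map (Rat.cast : ℚ → ℝ) = M.map (Rat.cast : ℚ → ℝ) - N.map (Rat.cast : ℚ → ℝ) := by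
  ext i k; simp
/-- `(q • M) ↦ ℝ` (cast plumbing). -/ private theorem map_smul' {m n : Type*} (q : ℚ) (M : Matrix m n ℚ) :
    (q • M).map (Rat.cast : ℚ → ℝ) = ((q : ℚ) : ℝ) • M.map (Rat.cast : ℚ → ℝ) := by
  ext i k; simp
/-- `(M N) ↦ ℝ` (cast plumbing). -/ private theorem map_mul' {l m n : Type*} [Fintype m] (M : Matrix l m ℚ) (N : Matrix m n ℚ) :
    (M * N).map (Rat.cast : ℚ → ℝ) = M.map (Rat.cast : ℚ → ℝ) * N.map (Rat.cast : ℚ → ℝ) := by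
  ext i k; simp [Matrix.mul_apply]
/-- `Mᵀ ↦ ℝ` (cast plumbing). -/ private theorem map_transpose' {m n : Type*} (M : Matrix m n ℚ) :
    Mᵀ.map (Rat.cast : ℚ → ℝ) = (M.map (Rat.cast : ℚ → ℝ))ᵀ := by
  ext i k; simp

/-! ### The witness data over `ℝ` -/

/-- `Z₁₁ ↦ ℝ`. -/
def Z₁₁ : Matrix (Fin 3 ⊕ Fin 2) (Fin 3 ⊕ Fin 2) ℝ := Z11Q.map (Rat.cast : ℚ → ℝ)
/-- `Z₂₁ ↦ ℝ`. -/
def Z₂₁ : Matrix ((Fin 3 × Fin 3) ⊕ (Fin 3 × Fin 3)) (Fin 3 ⊕ Fin 2) ℝ := Z21Q.map (Rat.cast : ℚ → ℝ)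
/-- `Z₂₂ ↦ ℝ`. -/
def Z₂₂ : Matrix ((Fin 3 × Fin 3) ⊕ (Fin 3 × Fin 3)) ((Fin 3 × Fin 3) ⊕ (Fin 3 × Fin 3)) ℝ := Z22Q.map (Rat.cast : ℚ → ℝ)
/-- The witness's lower slopes over `ℝ`. -/
def a0 (k : (Fin 3 × Fin 3) ⊕ (Fin 3 × Fin 3)) : ℝ := (a0K k : ℝ)
/-- The witness's upper slopes over `ℝ`. -/
def b0 (k : (Fin 3 × Fin 3) ⊕ (Fin 3 × Fin 3)) : ℝ := (b0K k : ℝ)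
/-- The window `γ₀ = 2·arctan(71/1000)` (≈ 8.122°). -/
def γ₀ : ℝ := 2 * Real.arctan ((u0Q : ℚ) : ℝ)

/-- `γ₀` is the literal window `2·arctan(71/1000)` of the row's name. -/
theorem γ₀_eq : γ₀ = 2 * Real.arctan (71 / 1000 : ℝ) := by
  unfold γ₀; norm_num [u0Q]

/-- `cos γ₀ = cg0Q` (cast form, feeds `hwin`; private: text-twin of ★ #74's). -/
private theorem cos_γ₀_cast : Real.cos γ₀ = ((cg0Q : ℚ) : ℝ) := by
  unfold γ₀ cg0Q
  rw [Lyapunov.StructurePreserving.cos_two_mul_arctan]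
  push_cast
  ring

/-- `sin γ₀ = sg0Q` (cast form, feeds `hwin`; private: text-twin of ★ #74's). -/
private theorem sin_γ₀_cast : Real.sin γ₀ = ((sg0Q : ℚ) : ℝ) := by
  unfold γ₀ sg0Q
  rw [Lyapunov.StructurePreserving.sin_two_mul_arctan]
  push_cast
  ring

/-- **`cos(2·arctan(71/1000)) = 994959/1005041`**, **`sin = 142000/1005041`** (closed forms). -/
theorem cos_sin_γ₀ : Real.cos (2 * Real.arctan (71 / 1000 : ℝ)) = 994959 / 1005041 ∧ Real.sin (2 * Real.arctan (71 / 1000 : ℝ)) = 142000 / 1005041 := by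
  rw [← γ₀_eq, cos_γ₀_cast, sin_γ₀_cast]; constructor <;> norm_num [cg0Q, sg0Q, u0Q]

/-- `0 ≤ γ₀ < π/2`. -/
theorem γ₀_range : 0 ≤ γ₀ ∧ γ₀ < π / 2 := by
  have hu : (0 : ℝ) ≤ ((u0Q : ℚ) : ℝ) := by exact_mod_cast u0Q_pos_lt.1.le
  have hu1 : ((u0Q : ℚ) : ℝ) < 1 := by exact_mod_cast u0Q_pos_lt.2
  exact ⟨Lyapunov.StructurePreserving.two_mul_arctan_nonneg hu,
    Lyapunov.StructurePreserving.two_mul_arctan_lt_pi_div_two hu1⟩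

/-- `γ₀ ≤ 71 / 500` rad (`arctan u ≤ u`). -/
theorem γ₀_le : γ₀ ≤ 71 / 500 := by
  unfold γ₀
  have h : Real.arctan ((u0Q : ℚ) : ℝ) ≤ ((u0Q : ℚ) : ℝ) :=
    Lyapunov.StructurePreserving.arctan_le_self (by exact_mod_cast u0Q_pos_lt.1.le)
  have : ((u0Q : ℚ) : ℝ) = 71 / 1000 := by norm_num [u0Q]
  linarith

/-! ### `Z ⪰ 0` and (D1) over `ℝ` -/

/-- The receptacle's block matrix is `ZQ ↦ ℝ`. -/
theorem fromBlocks_eq : Matrix.fromBlocks Z₁₁ Z₂₁ᵀ Z₂₁ Z₂₂ = ZQ.map (Rat.cast : ℚ → ℝ) := by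
  rw [ZQ, Matrix.fromBlocks_map, Z₁₁, Z₂₁, Z₂₂, map_transpose']

/-- **`Z ⪰ 0`.** -/
theorem psd : (Matrix.fromBlocks Z₁₁ Z₂₁ᵀ Z₂₁ Z₂₂).PosSemidef := by
  rw [fromBlocks_eq]
  have h := (ZQ_ldl.posSemidef (R := ℝ)).submatrix e2
  have e : ((ZQ.submatrix ⇑e2.symm ⇑e2.symm).map (Rat.cast : ℚ → ℝ)).submatrix e2 e2
      = ZQ.map (Rat.cast : ℚ → ℝ) := by
    ext i j; simp
  rwa [e] at h

/-- **The adjoint image is rational**: `W + Wᵀ = HQ ↦ ℝ` (from `A_eq`, `B_eq`: no weight box on this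
presentation). -/
theorem adj_eq : dualAdjP WSCC9.splitLurieLinesSystem Z₁₁ Z₂₁ + (dualAdjP WSCC9.splitLurieLinesSystem Z₁₁ Z₂₁)ᵀ
    = HQ.map (Rat.cast : ℚ → ℝ) := by
  have hX : dualAdjP WSCC9.splitLurieLinesSystem Z₁₁ Z₂₁ = XQ.map (Rat.cast : ℚ → ℝ) := by
    rw [dualAdjP, A_eq, B_eq, Z₁₁, Z₂₁, XQ, map_sub', map_add', map_mul', map_mul', map_transpose',
      map_smul', map_mul', Rat.cast_ofNat]
  rw [hX, HQ, map_add', map_transpose']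

/-- **(D1)** `W + Wᵀ ⪰ 0`. -/
theorem adjP_psd :
    (dualAdjP WSCC9.splitLurieLinesSystem Z₁₁ Z₂₁ + (dualAdjP WSCC9.splitLurieLinesSystem Z₁₁ Z₂₁)ᵀ).PosSemidef := by
  rw [adj_eq]
  have h := (HQ_ldl.posSemidef (R := ℝ)).submatrix e1
  have e : ((HQ.submatrix ⇑e1.symm ⇑e1.symm).map (Rat.cast : ℚ → ℝ)).submatrix e1 e1
      = HQ.map (Rat.cast : ℚ → ℝ) := by
    ext i j; simp
  rwa [e] at h

/-! ### (D2), (D3), (D4) and the null channels over `ℝ` -/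

/-- `C·B = 0` for the typed split object. -/
theorem C_mul_B : WSCC9.splitLurieLinesSystem.C * WSCC9.splitLurieLinesSystem.B = 0 := by
  rw [C_eq, B_eq, ← map_mul', CQ_mul_BLQ, Matrix.map_zero _ Rat.cast_zero]

/-- The four dual functionals are the casts of `UQ`, `VQ`, `WQ`, `SQ`. -/
theorem functionals_eq (k : (Fin 3 × Fin 3) ⊕ (Fin 3 × Fin 3)) :
    (WSCC9.splitLurieLinesSystem.C * Z₁₁ * WSCC9.splitLurieLinesSystem.Cᵀ) k k = ((UQ k : ℚ) : ℝ) ∧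
    (Z₂₁ * WSCC9.splitLurieLinesSystem.Cᵀ) k k = ((VQ k : ℚ) : ℝ) ∧
    Z₂₂ k k = ((WQ k : ℚ) : ℝ) ∧
    dualPopovCoeff WSCC9.splitLurieLinesSystem Z₂₁ Z₂₂ k = ((SQ k : ℚ) : ℝ) := by
  refine ⟨?_, ?_, ?_, ?_⟩
  · rw [C_eq, Z₁₁, ← map_transpose', ← map_mul', ← map_mul', Matrix.map_apply, UQ]
  · rw [C_eq, Z₂₁, ← map_transpose', ← map_mul', Matrix.map_apply, VQ]
  · rw [Z₂₂, Matrix.map_apply, WQ]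
  · rw [dualPopovCoeff, Matrix.mul_assoc, ← Matrix.mul_assoc WSCC9.splitLurieLinesSystem.C, C_mul_B,
      Matrix.zero_mul, Matrix.zero_apply, sub_zero, C_eq, A_eq, Z₂₁, ← map_mul', ← map_transpose',
      ← map_mul', Matrix.map_apply, SQ]

/-- **(D2)** at the witness slopes. -/
theorem sectorCoeff_nonneg (k : (Fin 3 × Fin 3) ⊕ (Fin 3 × Fin 3)) :
    0 ≤ dualSectorCoeff WSCC9.splitLurieLinesSystem Z₁₁ Z₂₁ Z₂₂ a0 b0 k := by
  obtain ⟨hU, hV, hW, -⟩ := functionals_eq k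
  rw [dualSectorCoeff, hU, hV, hW, a0, b0]
  exact_mod_cast (dual_tests k).1

/-- **(D3)** on the admissible channels. -/
theorem popovCoeff_nonneg (k : (Fin 3 × Fin 3) ⊕ (Fin 3 × Fin 3)) (hk : 0 ≤ a0 k) :
    0 ≤ dualPopovCoeff WSCC9.splitLurieLinesSystem Z₂₁ Z₂₂ k := by
  rw [(functionals_eq k).2.2.2]
  have hk' : 0 ≤ a0K k := by unfold a0 at hk; exact_mod_cast hk
  exact_mod_cast (dual_tests k).2.1 hk'

/-- **(D4a)** `a0 < b0`. -/
theorem slope_lt (k : (Fin 3 × Fin 3) ⊕ (Fin 3 × Fin 3)) : a0 k < b0 k := by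
  unfold a0 b0; exact_mod_cast (dual_tests k).2.2.1

/-- **(D4b)** `tr Z₁₁ > 0`. -/
theorem trace_pos : 0 < Matrix.trace Z₁₁ := by
  have h : Matrix.trace Z₁₁ = ((Matrix.trace Z11Q : ℚ) : ℝ) := by
    simp [Z₁₁, Matrix.trace, Rat.cast_sum]
  rw [h]; exact_mod_cast trace_test

/-- **THE DUAL WITNESS** against the slab/Popov certificate class on `S = WSCC9.splitLurieLinesSystem` at the
window-end-point slopes `(a0, b0)` of the window `γ₀ = 2·arctan(71/1000)`.
[cite: BoydVandenberghe2004, §5.9.4 (5.97)–(5.98), Example 5.14] -/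
def D : SlabDualWitness WSCC9.splitLurieLinesSystem a0 b0 where
  Z₁₁ := Z₁₁
  Z₂₁ := Z₂₁
  Z₂₂ := Z₂₂
  psd := psd
  adjP_psd := adjP_psd
  sectorCoeff_nonneg := sectorCoeff_nonneg
  popovCoeff_nonneg := popovCoeff_nonneg
  slope_lt := slope_lt
  trace_pos := trace_pos

/-- The diagonal channels (both families) are NULL for the witness. -/
theorem isNull_diag (k : (Fin 3 × Fin 3) ⊕ (Fin 3 × Fin 3)) (hk : (pairOf k).1 = (pairOf k).2) : D.IsNull k := by
  obtain ⟨hU, hV, hW, hS⟩ := functionals_eq k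
  obtain ⟨h1, h2, h3, h4⟩ := (dual_tests k).2.2.2 hk
  refine ⟨?_, ?_, ?_, ?_⟩
  · show (WSCC9.splitLurieLinesSystem.C * Z₁₁ * WSCC9.splitLurieLinesSystem.Cᵀ) k k = 0; rw [hU]; exact_mod_cast h1
  · show (Z₂₁ * WSCC9.splitLurieLinesSystem.Cᵀ) k k = 0; rw [hV]; exact_mod_cast h2
  · show Z₂₂ k k = 0; rw [hW]; exact_mod_cast h3
  · show dualPopovCoeff WSCC9.splitLurieLinesSystem Z₂₁ Z₂₂ k = 0; rw [hS]; exact_mod_cast h4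

/-! ### The window end points of the twelve channels `p ≠ q` (exact cosines) -/

/-- The two window end points `δ ± γ` and their cosines from `(cos δ, sin δ) = (cδ, sδ)`,
`(cos γ, sin γ) = (c, s)`. -/
private theorem window_points {δ γ cδ sδ c s : ℝ} (hc : Real.cos δ = cδ) (hs : Real.sin δ = sδ)
    (hcg : Real.cos γ = c) (hsg : Real.sin γ = s) (hγ : 0 ≤ γ) :
    (∃ ξ, |ξ - δ| ≤ γ ∧ Real.cos ξ = cδ * c - sδ * s) ∧ (∃ ξ, |ξ - δ| ≤ γ ∧ Real.cos ξ = cδ * c + sδ * s) :=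
  ⟨⟨δ + γ, by simp [abs_of_nonneg hγ], by rw [Real.cos_add, hc, hs, hcg, hsg]⟩,
    ⟨δ - γ, by simp [abs_of_nonneg hγ], by rw [Real.cos_sub, hc, hs, hcg, hsg]⟩⟩

/-- **`hwin`**: every channel is NULL or has window points `ξa`, `ξb` in `|ξ − δ*_k| ≤ γ₀` with
`cos ξa ≤ a0_k`, `b0_k ≤ cos ξb` — the end points `δ*_k ± γ₀`, whose exact cosines `window_tests_sin/_cos`
compare with `a0/b0` in the kernel. -/
theorem hwin : ∀ k, D.IsNull k ∨
    ((∃ ξ, |ξ - WSCC9.splitLurieLinesSystem.δs k| ≤ γ₀ ∧ Real.cos ξ ≤ a0 k) ∧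
      ∃ ξ, |ξ - WSCC9.splitLurieLinesSystem.δs k| ≤ γ₀ ∧ b0 k ≤ Real.cos ξ) := by
  rintro (⟨p, q⟩ | ⟨p, q⟩)
  · by_cases hpq : p = q
    · exact Or.inl (isNull_diag _ hpq)
    right
    have hδs : WSCC9.splitLurieLinesSystem.δs (Sum.inl (p, q))
        = WSCC9.postB_SPdamp.angleOf p - WSCC9.postB_SPdamp.angleOf q := rfl
    obtain ⟨⟨ξ₁, hξ₁, hc₁⟩, ξ₂, hξ₂, hc₂⟩ := window_points (WSCC9.cos_angleOf_sub p q)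
      (WSCC9.sin_angleOf_sub p q) cos_γ₀_cast sin_γ₀_cast γ₀_range.1
    obtain ⟨hlo, hhi⟩ := window_tests_sin p q hpq
    rw [hδs]
    refine ⟨?_, ?_⟩
    · rcases hlo with h | h
      · exact ⟨ξ₁, hξ₁, by rw [hc₁, a0]; exact_mod_cast h⟩
      · exact ⟨ξ₂, hξ₂, by rw [hc₂, a0]; exact_mod_cast h⟩
    · rcases hhi with h | h
      · exact ⟨ξ₁, hξ₁, by rw [hc₁, b0]; exact_mod_cast h⟩
      · exact ⟨ξ₂, hξ₂, by rw [hc₂, b0]; exact_mod_cast h⟩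
  · by_cases hpq : p = q
    · exact Or.inl (isNull_diag _ hpq)
    right
    have hδs : WSCC9.splitLurieLinesSystem.δs (Sum.inr (p, q))
        = WSCC9.postB_SPdamp.angleOf p - WSCC9.postB_SPdamp.angleOf q + π / 2 := rfl
    have hc : Real.cos (WSCC9.postB_SPdamp.angleOf p - WSCC9.postB_SPdamp.angleOf q + π / 2)
        = -((WSCC9.postB_SPdamp.sd p q : ℚ) : ℝ) := by
      rw [Real.cos_add_pi_div_two, WSCC9.sin_angleOf_sub]
    have hs : Real.sin (WSCC9.postB_SPdamp.angleOf p - WSCC9.postB_SPdamp.angleOf q + π / 2)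
        = ((WSCC9.postB_SPdamp.cd p q : ℚ) : ℝ) := by
      rw [Real.sin_add_pi_div_two, WSCC9.cos_angleOf_sub]
    obtain ⟨⟨ξ₁, hξ₁, hc₁⟩, ξ₂, hξ₂, hc₂⟩ := window_points hc hs cos_γ₀_cast sin_γ₀_cast γ₀_range.1
    obtain ⟨hlo, hhi⟩ := window_tests_cos p q hpq
    rw [hδs]
    refine ⟨?_, ?_⟩
    · rcases hlo with h | h
      · exact ⟨ξ₁, hξ₁, by rw [hc₁, a0]; exact_mod_cast h⟩
      · exact ⟨ξ₂, hξ₂, by rw [hc₂, a0]; exact_mod_cast h⟩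
    · rcases hhi with h | h
      · exact ⟨ξ₁, hξ₁, by rw [hc₁, b0]; exact_mod_cast h⟩
      · exact ⟨ξ₂, hξ₂, by rw [hc₂, b0]; exact_mod_cast h⟩

/-! ### THE THEOREM -/

/-- **No split slab certificate at the window `γ₀`.**  No `Λ : SlabCertificate WSCC9.splitLurieLinesSystem`
satisfies the sector hypothesis of lit-6's ROA theorem on the window `|ξ − δ*_k| ≤ γ₀ = 2·arctan(71/1000)`:
the dual witness `D` refutes it (weak theorem of alternatives).  CERTIFIED sentence: the typed split
certificate class is EMPTY at `γ₀` — a statement about certificates, not about trajectories of `M′`.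
[cite: BoydVandenberghe2004, §5.9.4 (5.97)–(5.98), Example 5.14] -/
theorem no_splitSlabCertificate_at (Λ : SlabCertificate WSCC9.splitLurieLinesSystem)
    (hsec : ∀ k ξ, |ξ - WSCC9.splitLurieLinesSystem.δs k| ≤ γ₀ → Λ.a k ≤ Real.cos ξ ∧ Real.cos ξ ≤ Λ.b k) :
    False :=
  Λ.false_of_dualWitness_of_exists_window D (γ := fun _ => γ₀) hsec hwin

/-- **No split slab certificate at any window `γ ≥ γ₀`** (the sector hypothesis for `γ` implies it for `γ₀`). -/
theorem no_splitSlabCertificate (Λ : SlabCertificate WSCC9.splitLurieLinesSystem) {γ : ℝ} (hγ : γ₀ ≤ γ)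
    (hsec : ∀ k ξ, |ξ - WSCC9.splitLurieLinesSystem.δs k| ≤ γ → Λ.a k ≤ Real.cos ξ ∧ Real.cos ξ ≤ Λ.b k) :
    False :=
  no_splitSlabCertificate_at Λ fun k ξ hξ => hsec k ξ (hξ.trans hγ)

/-- **The split class is empty from `γ₀` on** (set form). -/
theorem splitSlabClass_empty (γ : ℝ) (hγ : γ₀ ≤ γ) :
    ¬ ∃ Λ : SlabCertificate WSCC9.splitLurieLinesSystem,
      ∀ k ξ, |ξ - WSCC9.splitLurieLinesSystem.δs k| ≤ γ → Λ.a k ≤ Real.cos ξ ∧ Real.cos ξ ≤ Λ.b k :=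
  fun ⟨Λ, hsec⟩ => no_splitSlabCertificate Λ hγ hsec

/-- **Per-channel windows**: the refutation needs the window only on the twelve channels `p ≠ q` and only
`γ_k ≥ γ₀` there (anything on the six null diagonal channels). -/
theorem no_splitSlabCertificate_perChannel (Λ : SlabCertificate WSCC9.splitLurieLinesSystem) (γ : (Fin 3 × Fin 3) ⊕ (Fin 3 × Fin 3) → ℝ)
    (hγ : ∀ k, (pairOf k).1 ≠ (pairOf k).2 → γ₀ ≤ γ k)
    (hsec : ∀ k ξ, |ξ - WSCC9.splitLurieLinesSystem.δs k| ≤ γ k → Λ.a k ≤ Real.cos ξ ∧ Real.cos ξ ≤ Λ.b k) :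
    False := by
  refine Λ.false_of_dualWitness_of_exists_window D (γ := γ) hsec fun k => ?_
  by_cases hk : (pairOf k).1 = (pairOf k).2
  · exact Or.inl (isNull_diag k hk)
  · rcases hwin k with h | ⟨⟨ξa, hξa, hca⟩, ξb, hξb, hcb⟩
    · exact Or.inl h
    · exact Or.inr ⟨⟨ξa, hξa.trans (hγ k hk), hca⟩, ξb, hξb.trans (hγ k hk), hcb⟩

/-- **THE BRACKET** (one kernel object for the row's sentence «split class optimum ∈ (8.008°, 8.122°]»):
the typed split class is NON-EMPTY at #122's window `2·arctan(7/100)` (`WSCC9LossySplitLines.cert` with its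
`hsec`) and EMPTY at every window `≥ γ₀ = 2·arctan(71/1000)`. -/
theorem splitClassCeiling_bracket :
    (∃ Λ : SlabCertificate WSCC9.splitLurieLinesSystem,
      ∀ k ξ, |ξ - WSCC9.splitLurieLinesSystem.δs k| ≤ 2 * Real.arctan (7 / 100 : ℝ) → Λ.a k ≤ Real.cos ξ ∧ Real.cos ξ ≤ Λ.b k) ∧
    ∀ γ' : ℝ, γ₀ ≤ γ' → ¬ ∃ Λ : SlabCertificate WSCC9.splitLurieLinesSystem,
      ∀ k ξ, |ξ - WSCC9.splitLurieLinesSystem.δs k| ≤ γ' → Λ.a k ≤ Real.cos ξ ∧ Real.cos ξ ≤ Λ.b k :=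
  ⟨⟨WSCC9LossySplitLines.cert, Bench.WSCC9LossySplitLines.hsec⟩, splitSlabClass_empty⟩

/-- **THE PRESENTATION LEVER** (one kernel object): at the SAME window `2·arctan(7/100)` on the SAME machine
model M′, the directed-polar slab class of record (`SlabCertificate WSCC9.lurieSystem`, ★ #35 / ★ #74) is
EMPTY while the unordered-lines split slab class (`SlabCertificate WSCC9.splitLurieLinesSystem`, #122) is NON-EMPTY. -/
theorem presentationLever :
    (¬ ∃ Λ : SlabCertificate WSCC9.lurieSystem,
      ∀ k ξ, |ξ - WSCC9.lurieSystem.δs k| ≤ WSCC9LossySlabDual.γ₀ → Λ.a k ≤ Real.cos ξ ∧ Real.cos ξ ≤ Λ.b k) ∧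
    WSCC9LossySlabDual.γ₀ = 2 * Real.arctan (7 / 100 : ℝ) ∧
    ∃ Λ : SlabCertificate WSCC9.splitLurieLinesSystem,
      ∀ k ξ, |ξ - WSCC9.splitLurieLinesSystem.δs k| ≤ 2 * Real.arctan (7 / 100 : ℝ) → Λ.a k ≤ Real.cos ξ ∧ Real.cos ξ ≤ Λ.b k :=
  ⟨WSCC9LossySlabDual.slabClass_empty _ le_rfl, by unfold WSCC9LossySlabDual.γ₀; norm_num [WSCC9LossySlabDual.u0Q],
    splitClassCeiling_bracket.1⟩

/-- The two windows of the bracket in closed form: `2·arctan(7/100) < γ₀ = 2·arctan(71/1000)`. -/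
theorem γ_lt_γ₀ : 2 * Real.arctan (7 / 100 : ℝ) < γ₀ := by
  unfold γ₀
  have h : (7 / 100 : ℝ) < ((u0Q : ℚ) : ℝ) := by norm_num [u0Q]
  have := Real.arctan_strictMono h
  linarith

end Summit.Ventures.GridStability.Lyapunov.WSCC9LossySplitLinesDual

end
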